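import Literature.Analysis.FluidPDE.ConstantinFeffermanEnstrophySlab
import Literature.Analysis.FluidPDE.ConstantinFeffermanStretching
import Literature.Analysis.FluidPDE.TaoEnstrophyLocalisationProofs
import HarnessLib

/-!
# The vorticity `L²` balance WITH A FORCE on a closed slab, Grönwall under an abstract
# stretching bound, and two instances: Beale–Kato–Majda and Constantin–Fefferman with force

Analysis/FluidPDE proof file (theorems only: no definition, no named fact, no `sorry`). Cell
`ns-blowup`, seat `ns-blowup-ecbridge-2` (g9, E–C endpoint theory). WHAT THIS IS NOT: not a
statement about Navier–Stokes blow-up — a-priori bounds for classical solutions of the FORCED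
system on a closed slab; the consumers are the necessary conditions on the (uninhabited) E–C types.

For a classical solution `(u, p)` of the forced Navier–Stokes system
`∂ₜu + (u·∇)u = νΔu − ∇p + f`, `div u = 0` (`ν > 0`) on a closed slab `[0, T''] × ℝ³` in Tao's
`L²`-Sobolev class (`HasBoundedSobolevNormsOn`), the vorticity `ω = curl u` obeys
`∂ₜω + (u·∇)ω = (ω·∇)u + νΔω + curl f` (the tree's `IsClassicalNSSolutionOn.curl_timeDerivWithin_eq`,
Majda–Bertozzi 2002, (1.33) with force; Tao 2013, (10.18)), hence the balance

  `d/dt ∫|ω|² = −2ν ∫|∇ω|² + 2∫⟪ω, (∇u)ω⟫ + 2∫⟪ω, curl f⟫`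

(`integral_inner_curl_eq_of_vorticity_eq_forced`: the tree's unforced fixed-time identity
`integral_inner_curl_eq_of_vorticity_eq`, Lemarié-Rieusset 2016, (11.60), fed `∂ₜω − curl f`).
Under an ABSTRACT stretching bound `2∫⟪ω, (∇u)ω⟫ ≤ ν∫|∇ω|² + α(t)∫|ω|² + C₄∫|∇u|²` with
`α ≥ 0`, `∫₀^{T''} α < ∞`, Grönwall's lemma (`lintegral_gronwall_le`) gives
(`sq_norm_curl_le_of_stretching_forced`)

  `∫|ω(t)|² ≤ (∫|ω(0)|² + C₄ I + G T'') · exp(∫₀^{T''} α + T'')`,  `t ∈ [0, T'']`,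

`I ≥ ∫₀^{T''}∫|∇u|²`, `G ≥ sup_t ∫|curl f(t)|²` (the force term by `2⟪ω, curl f⟫ ≤ |ω|² + |curl f|²`).
Two instances:

* **Beale–Kato–Majda with force, `H¹` form** (`sq_norm_curl_le_of_vorticity_sup_forced`,
  `lintegral_frobeniusNormSq_le_of_vorticity_sup_forced`): `α(t) = 2‖ω(t)‖_{L^∞}`, `C₄ = 0`
  (pointwise `⟪ω, (∇u)ω⟫ ≤ ‖ω‖_∞ |∇u| |ω|` and the `div`–`curl` estimate `∫|∇u|² ≤ ∫|ω|²`):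
  `∫|∇u(t)|² ≤ ∫|ω(t)|² ≤ (∫|ω(0)|² + G T'') exp(2∫₀^{T''}‖ω‖_∞ + T'')` — for `ν > 0` the printed
  BKM theorem (Beale–Kato–Majda 1984, Thm. 1; Majda–Bertozzi 2002, Thm. 3.6, remark p. 117 "the
  proof applies equally to Navier–Stokes", and (3.80)–(3.82) `‖ω(t)‖₀ ≤ ‖ω₀‖₀ exp(c∫|∇v|_∞)`)
  needs no potential-theory estimate once the continuation criterion is the `H¹` norm (Leray):
  the enstrophy is controlled by `∫‖ω‖_∞` directly, force included.
* **Constantin–Fefferman with force** (`sq_norm_curl_le_of_direction_slab_forced`):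
  `α(t) = C₁ + C₂∫|ω(t)|² + C₃Ē` from the tree's purely spatial stretching estimate under the
  direction hypothesis (`exists_two_mul_integral_stretching_le`, Constantin–Fefferman 1993 §2),
  `∫₀^{T''} α ≤ (C₁ + C₃Ē)T'' + C₂‖curl‖²I`: the forced twin of the tree's
  `integral_sq_norm_curl_le_of_direction_slab`.

## Mathlib / tree search

Tree (all used): `integral_inner_curl_eq_of_vorticity_eq`, `lintegral_enorm_sq_le_of_norm_le_three`,
`norm_iteratedFDeriv_curl_le_opNorm_mul` (`ConstantinFeffermanEnstrophySlab`);
`IsClassicalNSSolutionOn.curl_timeDerivWithin_eq` (`VorticityStretching`, WITH force);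
`IsSmoothSpaceTimeOn.curl_timeDerivWithin_of_uniqueDiffOn` (`VorticityFormulationProofs`);
`IsSmoothSpaceTimeOn.l2_balance` (`ClassicalL2Stability`); `lintegral_gronwall_le`
(`SerrinEnstrophyGronwall`); `lintegral_frobeniusNormSq_fderiv_le_lintegral_sq_norm_curl`
(`TaoEnstrophyLocalisationProofs`); `exists_two_mul_integral_stretching_le`
(`ConstantinFeffermanStretching`); `linfty_bound_of_hasBoundedSobolevNormsOn_holds`,
`exists_forall_norm_fderiv_le_of_hasBoundedSobolevNormsOn`,
`exists_forall_norm_fderiv_fderiv_le_of_hasBoundedSobolevNormsOn`. `lean search 'forced' 'curl_eq_top'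
'vorticity_sup'`: the tree's BKM (`beale_kato_majda_holds`) and Constantin–Fefferman
(`constantin_fefferman_holds`) discharges are for the UNFORCED system only; no forced slab bound
existed. Mathlib: `AEMeasurable.lintegral_prod_right'`, `ContinuousOn.aemeasurable`,
`Measure.restrict_prod_eq_prod_univ` (measurability of the slab dissipation `t ↦ ∫|∇u(t)|²`).

## References

* J. T. Beale, T. Kato, A. Majda, *Remarks on the breakdown of smooth solutions for the 3-D Euler
  equations*, Comm. Math. Phys. 94 (1984) 61–66, Theorem 1. [BealeKatoMajda1984]
* A. J. Majda, A. L. Bertozzi, *Vorticity and Incompressible Flow*, CUP (2002), eq. (1.33),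
  Thm. 3.6 with (3.80)–(3.82) and the remark p. 117. [MajdaBertozzi2002]
* P. Constantin, C. Fefferman, Indiana Univ. Math. J. 42 (1993) 775–789, Theorem (§1), §2.
  [ConstantinFeffermanIndiana1993]
* P. G. Lemarié-Rieusset, *The Navier–Stokes Problem in the 21st Century*, CRC (2016), §11.6
  (11.60), Thm. 11.7. [LemarieRieusset2016]
* T. Tao, *Localisation and compactness properties of the Navier–Stokes global regularity
  problem*, Anal. PDE 6 (2013), §10 (10.18). [Tao2011]
-/

noncomputable section

open MeasureTheory Set Function Filter Metric Real InnerProductSpace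
open _root_.Topology
open scoped ENNReal NNReal RealInnerProductSpace ContDiff Laplacian

namespace Literature.Analysis.FluidPDE

-- nested operator types (second and third derivatives)
set_option maxSynthPendingDepth 3

/-! ### §0 Plumbing -/

/-- `ofReal (∫ f) ≤ ∫⁻ ofReal f` for every real function (junk value `0` if not integrable). [folklore] -/
private theorem ofReal_integral_le_lintegral_ofReal'' {α : Type*} [MeasurableSpace α] {μ : Measure α}
    (f : α → ℝ) : ENNReal.ofReal (∫ x, f x ∂μ) ≤ ∫⁻ x, ENNReal.ofReal (f x) ∂μ := by
  by_cases hf : Integrable f μ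
  · have hpos : Integrable (fun x => max (f x) 0) μ := hf.pos_part
    have h1 : ∫ x, f x ∂μ ≤ ∫ x, max (f x) 0 ∂μ := integral_mono hf hpos fun x => le_max_left _ _
    have h2 : ENNReal.ofReal (∫ x, max (f x) 0 ∂μ) = ∫⁻ x, ENNReal.ofReal (max (f x) 0) ∂μ :=
      ofReal_integral_eq_lintegral_ofReal hpos (Eventually.of_forall fun x => le_max_right _ _)
    have h3 : ∫⁻ x, ENNReal.ofReal (max (f x) 0) ∂μ = ∫⁻ x, ENNReal.ofReal (f x) ∂μ := by
      refine lintegral_congr fun x => ?_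
      rcases le_total (f x) 0 with h | h
      · rw [max_eq_right h, ENNReal.ofReal_of_nonpos h, ENNReal.ofReal_zero]
      · rw [max_eq_left h]
    calc ENNReal.ofReal (∫ x, f x ∂μ) ≤ ENNReal.ofReal (∫ x, max (f x) 0 ∂μ) := ENNReal.ofReal_le_ofReal h1
      _ = ∫⁻ x, ENNReal.ofReal (f x) ∂μ := by rw [h2, h3]
  · rw [integral_undef hf, ENNReal.ofReal_zero]
    exact zero_le

/-- The real `L²` mass of a continuous field with `∫⁻ ‖g‖ₑ² ≤ C` is at most `C.toReal`. [folklore] -/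
private theorem integral_sq_norm_le_toReal {G : Type*} [NormedAddCommGroup G]
    {g : EuclideanSpace ℝ (Fin 3) → G} (hg : Continuous g) {C : ℝ≥0∞} (hC : C ≠ ⊤)
    (h : ∫⁻ x, ‖g x‖ₑ ^ 2 ≤ C) : ∫ x, ‖g x‖ ^ 2 ≤ C.toReal := by
  have hi : Integrable fun x => ‖g x‖ ^ 2 :=
    integrable_sq_norm_of_lintegral_lt_top hg (h.trans_lt (lt_top_iff_ne_top.2 hC))
  have h' : ENNReal.ofReal (∫ x, ‖g x‖ ^ 2) ≤ C := by
    rw [ofReal_integral_eq_lintegral_ofReal hi (Eventually.of_forall fun x => sq_nonneg _)]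
    refine le_trans (le_of_eq (lintegral_congr fun x => ?_)) h
    rw [← ofReal_norm, ENNReal.ofReal_pow (norm_nonneg _)]
  exact (ENNReal.ofReal_le_iff_le_toReal hC).1 h'

/-! ### §1 The vorticity energy identity with a force -/

/-- **The vorticity energy identity WITH A FORCE** (Lemarié-Rieusset 2016, (11.60) with the curl of
the force added; Majda–Bertozzi 2002, (1.33)). Let `v ∈ C³(ℝ³; ℝ³)` be divergence free and bounded
with `∇v` bounded and `∇v, ∇²v, ∇³v ∈ L²`, `ω = curl v`, and let `W`, `g` be continuous square
integrable fields with `W + (v·∇)ω = (ω·∇)v + νΔω + g` pointwise (the forced vorticity equation at a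
fixed time: `W = ∂ₜω`, `g = curl f`). Then
`∫⟪ω, W⟫ = −ν ∫|∇ω|²_F + ∫⟪ω, (∇v) ω⟫ + ∫⟪ω, g⟫`:
the tree's unforced identity `integral_inner_curl_eq_of_vorticity_eq` applied to `W − g`.
[cite: LemarieRieusset2016, §11.6 (11.60)] [cite: MajdaBertozzi2002, eq. (1.33)] -/
theorem integral_inner_curl_eq_of_vorticity_eq_forced {ν : ℝ}
    {v W g : EuclideanSpace ℝ (Fin 3) → EuclideanSpace ℝ (Fin 3)} (hv : ContDiff ℝ 3 v)
    (hdiv : VectorCalculus.IsDivFree v)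
    (heq : ∀ x, W x + convect v (curl v) x = convect (curl v) v x + ν • (Δ (curl v)) x + g x)
    {B : ℝ} (hB : ∀ x, ‖v x‖ ≤ B) {B₁ : ℝ} (hB₁ : ∀ x, ‖fderiv ℝ v x‖ ≤ B₁)
    (h1 : ∫⁻ x, ‖iteratedFDeriv ℝ 1 v x‖ₑ ^ 2 < ⊤) (h2 : ∫⁻ x, ‖iteratedFDeriv ℝ 2 v x‖ₑ ^ 2 < ⊤)
    (h3 : ∫⁻ x, ‖iteratedFDeriv ℝ 3 v x‖ₑ ^ 2 < ⊤)
    (hW : Continuous W) (hWL2 : ∫⁻ x, ‖W x‖ₑ ^ 2 < ⊤)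
    (hg : Continuous g) (hgL2 : ∫⁻ x, ‖g x‖ₑ ^ 2 < ⊤) :
    ∫ x, ⟪curl v x, W x⟫ =
      -ν * (∫ x, frobeniusNormSq (fderiv ℝ (curl v) x)) +
        (∫ x, ⟪curl v x, fderiv ℝ v x (curl v x)⟫) + ∫ x, ⟪curl v x, g x⟫ := by
  -- the unforced part of the time derivative
  set W₁ : EuclideanSpace ℝ (Fin 3) → EuclideanSpace ℝ (Fin 3) := fun x => W x - g x with hW₁
  have heq₁ : ∀ x, W₁ x + convect v (curl v) x = convect (curl v) v x + ν • (Δ (curl v)) x := by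
    intro x
    have h := heq x
    simp only [hW₁]
    rw [sub_add_eq_add_sub, h, add_sub_cancel_right]
  have hid := integral_inner_curl_eq_of_vorticity_eq hv hdiv heq₁ hB hB₁ h1 h2 h3
  -- the vorticity is continuous and square integrable
  have hw1 : ContDiff ℝ 1 (curl v) := contDiff_curl (n := 1) (by exact hv.of_le (by norm_num))
  have cw : Continuous (curl v) := hw1.continuous
  have l2w : ∫⁻ x, ‖curl v x‖ₑ ^ 2 < ⊤ := by
    refine lintegral_enorm_sq_lt_top_of_norm_le (b := fun x => (‖curlCLM‖ : ℝ) • iteratedFDeriv ℝ 1 v x)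
      (fun x => ?_) (lintegral_enorm_sq_const_smul_lt_top _ h1)
    rw [norm_smul, Real.norm_of_nonneg (norm_nonneg _), norm_iteratedFDeriv_one]
    exact norm_curl_le v x
  -- integrability of the two pairings
  have iW : Integrable (fun x => ⟪curl v x, W x⟫) volume :=
    integrable_of_norm_le_mul_of_lintegral_sq (cw.inner hW).aestronglyMeasurable cw hW l2w hWL2
      fun x => norm_inner_le_norm _ _
  have ig : Integrable (fun x => ⟪curl v x, g x⟫) volume :=
    integrable_of_norm_le_mul_of_lintegral_sq (cw.inner hg).aestronglyMeasurable cw hg l2w hgL2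
      fun x => norm_inner_le_norm _ _
  have hsplit : ∫ x, ⟪curl v x, W₁ x⟫ = (∫ x, ⟪curl v x, W x⟫) - ∫ x, ⟪curl v x, g x⟫ := by
    rw [← integral_sub iW ig]
    refine integral_congr_ae (Eventually.of_forall fun x => ?_)
    simp only [hW₁, inner_sub_right]
  rw [hsplit] at hid
  linarith

/-! ### §2 Grönwall on a closed slab under an abstract stretching bound, with a force -/

set_option maxHeartbeats 1600000 in
/-- **The vorticity `L²` bound on a closed slab, WITH A FORCE, under an abstract stretching
bound** (the Grönwall step common to Beale–Kato–Majda and Constantin–Fefferman; Majda–Bertozzi 2002,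
(3.80)–(3.82); Lemarié-Rieusset 2016, end of the proof of Thm. 11.7). Let `(u, p)` be a classical
solution of the FORCED Navier–Stokes system on the closed slab `[0, T''] × ℝ³`, `ν > 0`, with all
`L²` Sobolev seminorms of `u` bounded there, `∫|curl f(t)|² ≤ G` on `[0, T'']` and dissipation
`∫₀^{T''}∫|∇u|² ≤ I`. Assume the stretching bound
`2∫⟪ω, (∇u)ω⟫ ≤ ν∫|∇ω|² + α(t)∫|ω|² + C₄∫|∇u|²` at every `t ∈ [0, T'']` with `α ≥ 0`,
`∫₀^{T''} α < ∞`, `C₄ ≥ 0`. Then for all `t ∈ [0, T'']`,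
`∫|ω(t)|² ≤ (∫|ω(0)|² + C₄ I + G T'') exp(∫₀^{T''} α + T'')`.
Proof: the `L²` balance of `ω` (`IsSmoothSpaceTimeOn.l2_balance`), the forced vorticity equation
(`curl_timeDerivWithin_eq`), the fixed-time identity `integral_inner_curl_eq_of_vorticity_eq_forced`,
`2⟪ω, curl f⟫ ≤ |ω|² + |curl f|²`, and `lintegral_gronwall_le` with the `L¹` kernel `α + 1`.
[cite: MajdaBertozzi2002, Thm. 3.6 proof, (3.80)-(3.82)] [cite: LemarieRieusset2016, Thm. 11.7 (proof)] -/
theorem sq_norm_curl_le_of_stretching_forced {ν T'' : ℝ} (hν : 0 < ν) (hT'' : 0 < T'')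
    {f u : ℝ → EuclideanSpace ℝ (Fin 3) → EuclideanSpace ℝ (Fin 3)}
    {p : ℝ → EuclideanSpace ℝ (Fin 3) → ℝ} (hS : IsClassicalNSSolutionOn (Icc 0 T'') ν f u p)
    (hB : HasBoundedSobolevNormsOn (Icc 0 T'') u)
    {G : ℝ≥0} (hG : ∀ t ∈ Icc 0 T'', ∫⁻ x, ‖curl (f t) x‖ₑ ^ 2 ≤ G)
    {I : ℝ} (hI : 0 ≤ I)
    (hdiss : ∫⁻ t in Ioo 0 T'', ∫⁻ x, ENNReal.ofReal (frobeniusNormSq (fderiv ℝ (u t) x)) ≤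
      ENNReal.ofReal I)
    {α : ℝ → ℝ} (hα : ∀ t, 0 ≤ α t)
    (hαT : ∫⁻ t in Ioo 0 T'', ENNReal.ofReal (α t) ≠ ⊤)
    {C₄ : ℝ} (hC₄ : 0 ≤ C₄)
    (hstr : ∀ t ∈ Icc 0 T'',
      2 * ∫ x, ⟪curl (u t) x, fderiv ℝ (u t) x (curl (u t) x)⟫ ≤
        ν * (∫ x, frobeniusNormSq (fderiv ℝ (curl (u t)) x)) +
          α t * (∫ x, ‖curl (u t) x‖ ^ 2) + C₄ * (∫ x, frobeniusNormSq (fderiv ℝ (u t) x))) :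
    ∀ t ∈ Icc 0 T'', ∫ x, ‖curl (u t) x‖ ^ 2 ≤
      ((∫ x, ‖curl (u 0) x‖ ^ 2) + C₄ * I + G * T'') *
        Real.exp ((∫⁻ s in Ioo 0 T'', ENNReal.ofReal (α s)).toReal + T'') := by
  have hU : UniqueDiffOn ℝ (Icc 0 T'') := uniqueDiffOn_Icc hT''
  have h0S : (0 : ℝ) ∈ Icc 0 T'' := ⟨le_rfl, hT''.le⟩
  set κ : ℝ := ‖curlCLM‖ with hκ
  -- smoothness of the slices
  have hsm : ∀ t ∈ Icc 0 T'', ContDiff ℝ ∞ (u t) := fun t ht => hS.contDiff_velocity ht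
  have hsm3 : ∀ t ∈ Icc 0 T'', ContDiff ℝ 3 (u t) := fun t ht => (hsm t ht).of_le (by norm_cast)
  have hsm2 : ∀ t ∈ Icc 0 T'', ContDiff ℝ 2 (u t) := fun t ht => (hsm t ht).of_le (by norm_cast)
  have hfsm : IsSmoothSpaceTimeOn (Icc 0 T'') f := hS.isSmoothSpaceTimeOn_force hU
  have hcf : ∀ t ∈ Icc 0 T'', Continuous (curl (f t)) := fun t ht =>
    (contDiff_curl (n := 1) (by exact (hfsm.contDiff_slice ht).of_le (by norm_cast))).continuous
  have hGt : ∀ t ∈ Icc 0 T'', ∫⁻ x, ‖curl (f t) x‖ₑ ^ 2 < ⊤ := fun t ht =>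
    (hG t ht).trans_lt ENNReal.coe_lt_top
  -- sup bounds
  obtain ⟨B₀, hB₀⟩ := linfty_bound_of_hasBoundedSobolevNormsOn_holds hsm2 hB
  obtain ⟨B₁, hB₁0, hB₁⟩ := exists_forall_norm_fderiv_le_of_hasBoundedSobolevNormsOn hsm3 hB
  have hB₀0 : 0 ≤ B₀ := (norm_nonneg _).trans (hB₀ 0 h0S 0)
  -- the Sobolev bounds
  have hfin : ∀ n, ∀ t ∈ Icc 0 T'', ∫⁻ x, ‖iteratedFDeriv ℝ n (u t) x‖ₑ ^ 2 < ⊤ := fun n t ht => by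
    obtain ⟨C, hC⟩ := hB n
    exact (hC t ht).trans_lt ENNReal.coe_lt_top
  choose Cn hCn using hB
  -- the vorticity field and its time derivative
  set vort : ℝ → EuclideanSpace ℝ (Fin 3) → EuclideanSpace ℝ (Fin 3) := vorticity u with hωdef
  have hωt : ∀ t, vort t = curl (u t) := fun t => rfl
  have hωsm : IsSmoothSpaceTimeOn (Icc 0 T'') vort :=
    (hS.smooth_velocity.fderiv_slice hU).clm_comp curlCLM
  set W : ℝ → EuclideanSpace ℝ (Fin 3) → EuclideanSpace ℝ (Fin 3) :=
    timeDerivWithin (Icc 0 T'') vort with hWdef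
  have hWsm : IsSmoothSpaceTimeOn (Icc 0 T'') W := hωsm.timeDerivWithin hU
  -- the FORCED vorticity equation
  have hvort : ∀ t ∈ Icc 0 T'', ∀ x,
      W t x + convect (u t) (vort t) x =
        convect (vort t) (u t) x + ν • (Δ (vort t)) x + curl (f t) x := by
    intro t ht x
    have e1 := hS.smooth_velocity.curl_timeDerivWithin_of_uniqueDiffOn hU ht x
    have e2 := hS.curl_timeDerivWithin_eq hU ht x
    have e3 : W t x = curl (timeDerivWithin (Icc 0 T'') u t) x := e1.symm
    rw [e3, e2, hωt]
    abel
  -- `L²` bound for the vorticity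
  set V₀ : ℝ≥0∞ := ENNReal.ofReal (κ ^ 2) * (Cn 1 : ℝ≥0∞) with hV₀
  have hV₀top : V₀ < ⊤ := ENNReal.mul_lt_top ENNReal.ofReal_lt_top ENNReal.coe_lt_top
  have hωL2 : ∀ t ∈ Icc 0 T'', ∫⁻ x, ‖vort t x‖ₑ ^ 2 ≤ V₀ := fun t ht =>
    (lintegral_curl_sq_le (u t)).trans (mul_le_mul' le_rfl (hCn 1 t ht))
  -- `L²` bound for the time derivative of the vorticity
  set V₁ : ℝ≥0∞ := 3 * (ENNReal.ofReal ((ν * (3 * κ)) ^ 2) * (Cn 3 : ℝ≥0∞) +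
    ENNReal.ofReal ((B₀ * κ) ^ 2) * (Cn 2 : ℝ≥0∞) + ENNReal.ofReal ((B₁ * κ) ^ 2) * (Cn 1 : ℝ≥0∞))
    with hV₁
  have hV₁top : V₁ < ⊤ := by
    refine ENNReal.mul_lt_top (by norm_num) ?_
    refine ENNReal.add_lt_top.2 ⟨ENNReal.add_lt_top.2 ⟨?_, ?_⟩, ?_⟩ <;>
      exact ENNReal.mul_lt_top ENNReal.ofReal_lt_top ENNReal.coe_lt_top
  set V₂ : ℝ≥0∞ := 3 * (ENNReal.ofReal (1 ^ 2) * V₁ + ENNReal.ofReal (1 ^ 2) * (G : ℝ≥0∞) +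
    ENNReal.ofReal (0 ^ 2) * (0 : ℝ≥0∞)) with hV₂
  have hV₂top : V₂ < ⊤ := by
    refine ENNReal.mul_lt_top (by norm_num) ?_
    refine ENNReal.add_lt_top.2 ⟨ENNReal.add_lt_top.2 ⟨?_, ?_⟩, ?_⟩
    · exact ENNReal.mul_lt_top ENNReal.ofReal_lt_top hV₁top
    · exact ENNReal.mul_lt_top ENNReal.ofReal_lt_top ENNReal.coe_lt_top
    · exact ENNReal.mul_lt_top ENNReal.ofReal_lt_top ENNReal.zero_lt_top
  have hWL2 : ∀ t ∈ Icc 0 T'', ∫⁻ x, ‖W t x‖ₑ ^ 2 ≤ V₂ := by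
    intro t ht
    have hv := hsm3 t ht
    have cWt : Continuous (W t) := (hWsm.contDiff_slice ht).continuous
    -- the unforced part `A = W − curl f`
    set A : EuclideanSpace ℝ (Fin 3) → EuclideanSpace ℝ (Fin 3) := fun x => W t x - curl (f t) x
      with hAdef
    have cA : Continuous A := cWt.sub (hcf t ht)
    have hAeq : ∀ x, A x = ν • (Δ (vort t)) x - convect (u t) (vort t) x + convect (vort t) (u t) x := by
      intro x
      have h := hvort t ht x
      simp only [hAdef]
      have : W t x = convect (vort t) (u t) x + ν • (Δ (vort t)) x + curl (f t) x
          - convect (u t) (vort t) x := eq_sub_of_add_eq h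
      rw [this]; abel
    have hpt : ∀ x, ‖A x‖ ≤ (ν * (3 * κ)) * ‖iteratedFDeriv ℝ 3 (u t) x‖ +
        (B₀ * κ) * ‖iteratedFDeriv ℝ 2 (u t) x‖ + (B₁ * κ) * ‖iteratedFDeriv ℝ 1 (u t) x‖ := by
      intro x
      have hw2 : ContDiff ℝ 2 (curl (u t)) := contDiff_curl (n := 2) (by exact hv)
      rw [hAeq x, hωt]
      have t1 : ‖ν • (Δ (curl (u t))) x‖ ≤ (ν * (3 * κ)) * ‖iteratedFDeriv ℝ 3 (u t) x‖ := by
        rw [norm_smul, Real.norm_of_nonneg hν.le, mul_assoc, mul_assoc]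
        refine mul_le_mul_of_nonneg_left ?_ hν.le
        calc ‖(Δ (curl (u t))) x‖ ≤ 3 * ‖iteratedFDeriv ℝ 2 (curl (u t)) x‖ :=
              norm_laplacian_le_three_mul_norm_iteratedFDeriv_two hw2 x
          _ ≤ 3 * (κ * ‖iteratedFDeriv ℝ 3 (u t) x‖) :=
              mul_le_mul_of_nonneg_left (norm_iteratedFDeriv_curl_le_opNorm_mul hv 2 (by norm_num) x)
                (by norm_num)
      have t2 : ‖convect (u t) (curl (u t)) x‖ ≤ (B₀ * κ) * ‖iteratedFDeriv ℝ 2 (u t) x‖ := by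
        rw [convect]
        calc ‖fderiv ℝ (curl (u t)) x (u t x)‖ ≤ ‖fderiv ℝ (curl (u t)) x‖ * ‖u t x‖ :=
              ContinuousLinearMap.le_opNorm _ _
          _ ≤ (κ * ‖iteratedFDeriv ℝ 2 (u t) x‖) * B₀ := by
              refine mul_le_mul ?_ (hB₀ t ht x) (norm_nonneg _) (by positivity)
              rw [← norm_iteratedFDeriv_one]
              exact norm_iteratedFDeriv_curl_le_opNorm_mul hv 1 (by norm_num) x
          _ = (B₀ * κ) * ‖iteratedFDeriv ℝ 2 (u t) x‖ := by ring
      have t3 : ‖convect (curl (u t)) (u t) x‖ ≤ (B₁ * κ) * ‖iteratedFDeriv ℝ 1 (u t) x‖ := by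
        rw [convect]
        calc ‖fderiv ℝ (u t) x (curl (u t) x)‖ ≤ ‖fderiv ℝ (u t) x‖ * ‖curl (u t) x‖ :=
              ContinuousLinearMap.le_opNorm _ _
          _ ≤ B₁ * (κ * ‖iteratedFDeriv ℝ 1 (u t) x‖) := by
              refine mul_le_mul (hB₁ t ht x) ?_ (norm_nonneg _) hB₁0
              have h := norm_iteratedFDeriv_curl_le_opNorm_mul hv 0 (by norm_num) x
              rwa [norm_iteratedFDeriv_zero] at h
          _ = (B₁ * κ) * ‖iteratedFDeriv ℝ 1 (u t) x‖ := by ring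
      have e1 : ‖ν • (Δ (curl (u t))) x - convect (u t) (curl (u t)) x + convect (curl (u t)) (u t) x‖ ≤
          ‖ν • (Δ (curl (u t))) x - convect (u t) (curl (u t)) x‖ + ‖convect (curl (u t)) (u t) x‖ :=
        norm_add_le _ _
      have e2 : ‖ν • (Δ (curl (u t))) x - convect (u t) (curl (u t)) x‖ ≤
          ‖ν • (Δ (curl (u t))) x‖ + ‖convect (u t) (curl (u t)) x‖ := norm_sub_le _ _
      linarith [e1, e2, t1, t2, t3]
    have hAL2 : ∫⁻ x, ‖A x‖ₑ ^ 2 ≤ V₁ := by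
      refine (lintegral_enorm_sq_le_of_norm_le_three ((hv.continuous_iteratedFDeriv le_rfl))
        (hv.continuous_iteratedFDeriv (by norm_num)) (hv.continuous_iteratedFDeriv (by norm_num))
        (by positivity) (by positivity) (by positivity) hpt).trans ?_
      rw [hV₁]
      exact mul_le_mul' le_rfl (add_le_add (add_le_add (mul_le_mul' le_rfl (hCn 3 t ht))
        (mul_le_mul' le_rfl (hCn 2 t ht))) (mul_le_mul' le_rfl (hCn 1 t ht)))
    -- `W = A + curl f`
    have hpt' : ∀ x, ‖W t x‖ ≤ 1 * ‖A x‖ + 1 * ‖curl (f t) x‖ +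
        0 * ‖(0 : EuclideanSpace ℝ (Fin 3))‖ := by
      intro x
      have : W t x = A x + curl (f t) x := by simp only [hAdef, sub_add_cancel]
      rw [this, one_mul, one_mul, zero_mul, add_zero]
      exact norm_add_le _ _
    refine (lintegral_enorm_sq_le_of_norm_le_three cA (hcf t ht) continuous_const
      zero_le_one zero_le_one le_rfl hpt').trans ?_
    rw [hV₂]
    gcongr
    · exact hG t ht
    · simp
  -- the balance of the vorticity `L²` mass
  obtain ⟨-, hYcont, hbal⟩ := hωsm.l2_balance hT'' (C₀ := V₀.toNNReal) (C₁ := V₂.toNNReal)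
    (fun t ht => by rw [ENNReal.coe_toNNReal hV₀top.ne]; exact hωL2 t ht)
    (fun t ht => by rw [ENNReal.coe_toNNReal hV₂top.ne]; exact hWL2 t ht)
  -- the quantities
  set Y : ℝ → ℝ := fun t => ∫ x, ‖vort t x‖ ^ 2 with hYdef
  set F : ℝ → ℝ := fun t => ∫ x, frobeniusNormSq (fderiv ℝ (u t) x) with hFdef
  set FE : ℝ → ℝ≥0∞ := fun t => ∫⁻ x, ENNReal.ofReal (frobeniusNormSq (fderiv ℝ (u t) x)) with hFEdef
  set Φ : ℝ → ℝ := fun t => ∫ x, 2 * ⟪vort t x, W t x⟫ with hΦdef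
  have hY0 : ∀ t, 0 ≤ Y t := fun t => integral_nonneg fun x => sq_nonneg _
  have hF0 : ∀ t, 0 ≤ F t := fun t => integral_nonneg fun x => frobeniusNormSq_nonneg _
  -- integrability of `|∇u(t)|²_F`, and `F` versus the dissipation
  have hFint : ∀ t ∈ Icc 0 T'', Integrable fun x => frobeniusNormSq (fderiv ℝ (u t) x) := by
    intro t ht
    have hlt : ∫⁻ x, ENNReal.ofReal (frobeniusNormSq (fderiv ℝ (u t) x)) < ⊤ := by
      calc ∫⁻ x, ENNReal.ofReal (frobeniusNormSq (fderiv ℝ (u t) x))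
          ≤ ∫⁻ x, 3 * ‖fderiv ℝ (u t) x‖ₑ ^ 2 :=
            lintegral_mono fun x => ofReal_frobeniusNormSq_le_three_mul_enorm_sq _
        _ = 3 * ∫⁻ x, ‖iteratedFDeriv ℝ 1 (u t) x‖ₑ ^ 2 := by
            rw [lintegral_const_mul' _ _ (by norm_num)]
            congr 1
            exact lintegral_congr fun x => by rw [← ofReal_norm, ← norm_iteratedFDeriv_one, ofReal_norm]
        _ < ⊤ := ENNReal.mul_lt_top (by norm_num) (hfin 1 t ht)
    exact integrable_of_continuous_of_nonneg (continuous_frobeniusNormSq_fderiv (hsm2 t ht) (by simp))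
      (fun x => frobeniusNormSq_nonneg _) hlt
  have hFof : ∀ t ∈ Icc 0 T'', ENNReal.ofReal (F t) = FE t := fun t ht =>
    ofReal_integral_eq_lintegral_ofReal (hFint t ht) (Eventually.of_forall fun x => frobeniusNormSq_nonneg _)
  have hIF : ∫⁻ t in Ioo 0 T'', FE t ≤ ENNReal.ofReal I := hdiss
  -- measurability of the slab dissipation `t ↦ FE t` (joint continuity and Tonelli)
  have hFEm : AEMeasurable FE ((volume : Measure ℝ).restrict (Icc 0 T'')) := by
    have hc : ContinuousOn (fun z : ℝ × EuclideanSpace ℝ (Fin 3) =>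
        ENNReal.ofReal (frobeniusNormSq (fderiv ℝ (u z.1) z.2))) (Icc 0 T'' ×ˢ univ) := by
      have h1 : ContinuousOn (uncurry fun t x => fderiv ℝ (u t) x) (Icc 0 T'' ×ˢ univ) :=
        (hS.smooth_velocity.fderiv_slice hU).continuousOn
      exact ENNReal.continuous_ofReal.comp_continuousOn
        (continuous_frobeniusNormSq_clm.comp_continuousOn h1)
    have h2 : AEMeasurable (fun z : ℝ × EuclideanSpace ℝ (Fin 3) =>
        ENNReal.ofReal (frobeniusNormSq (fderiv ℝ (u z.1) z.2)))
        (((volume : Measure ℝ).restrict (Icc 0 T'')).prod (volume : Measure (EuclideanSpace ℝ (Fin 3)))) := by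
      rw [Measure.restrict_prod_eq_prod_univ]
      exact hc.aemeasurable (measurableSet_Icc.prod MeasurableSet.univ)
    exact h2.lintegral_prod_right'
  -- real bound on the force term
  have hGreal : ∀ t ∈ Icc 0 T'', ∫ x, ‖curl (f t) x‖ ^ 2 ≤ (G : ℝ) := fun t ht => by
    have h := integral_sq_norm_le_toReal (hcf t ht) ENNReal.coe_ne_top (hG t ht)
    rwa [ENNReal.coe_toReal] at h
  -- `Y ≤ V₀`
  have hYV : ∀ t ∈ Icc 0 T'', ENNReal.ofReal (Y t) ≤ V₀ := by
    intro t ht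
    have hi : Integrable fun x => ‖vort t x‖ ^ 2 := by
      refine integrable_sq_norm_of_lintegral_lt_top (hωsm.contDiff_slice ht).continuous ?_
      exact (hωL2 t ht).trans_lt hV₀top
    rw [hYdef]
    show ENNReal.ofReal (∫ x, ‖vort t x‖ ^ 2) ≤ V₀
    rw [ofReal_integral_eq_lintegral_ofReal hi (Eventually.of_forall fun x => sq_nonneg _)]
    refine le_trans (le_of_eq (lintegral_congr fun x => ?_)) (hωL2 t ht)
    rw [← ofReal_norm, ENNReal.ofReal_pow (norm_nonneg _)]
  -- the slice inequality `Φ t ≤ (α t + 1) Y t + C₄ F t + G`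
  have hslice : ∀ t ∈ Icc 0 T'', Φ t ≤ (α t + 1) * Y t + C₄ * F t + G := by
    intro t ht
    have hv := hsm3 t ht
    have cWt : Continuous (W t) := (hWsm.contDiff_slice ht).continuous
    have hid := integral_inner_curl_eq_of_vorticity_eq_forced (g := curl (f t)) hv (hS.divFree t ht)
      (fun x => hvort t ht x) (hB₀ t ht) (hB₁ t ht) (hfin 1 t ht) (hfin 2 t ht) (hfin 3 t ht)
      cWt ((hWL2 t ht).trans_lt hV₂top) (hcf t ht) (hGt t ht)
    -- the force pairing: `2⟪ω, curl f⟫ ≤ |ω|² + |curl f|²`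
    have hw1 : ContDiff ℝ 1 (curl (u t)) := contDiff_curl (n := 1) (by exact hv.of_le (by norm_num))
    have cw : Continuous (curl (u t)) := hw1.continuous
    have l2w : ∫⁻ x, ‖curl (u t) x‖ₑ ^ 2 < ⊤ := (hωL2 t ht).trans_lt hV₀top
    have iY : Integrable fun x => ‖curl (u t) x‖ ^ 2 := integrable_sq_norm_of_lintegral_lt_top cw l2w
    have iG : Integrable fun x => ‖curl (f t) x‖ ^ 2 :=
      integrable_sq_norm_of_lintegral_lt_top (hcf t ht) (hGt t ht)
    have ifg : Integrable (fun x => ⟪curl (u t) x, curl (f t) x⟫) volume :=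
      integrable_of_norm_le_mul_of_lintegral_sq (cw.inner (hcf t ht)).aestronglyMeasurable cw (hcf t ht)
        l2w (hGt t ht) fun x => norm_inner_le_norm _ _
    have hforce : 2 * ∫ x, ⟪curl (u t) x, curl (f t) x⟫ ≤
        (∫ x, ‖curl (u t) x‖ ^ 2) + ∫ x, ‖curl (f t) x‖ ^ 2 := by
      rw [← integral_const_mul, ← integral_add iY iG]
      refine integral_mono (ifg.const_mul 2) (iY.add iG) fun x => ?_
      have h := abs_real_inner_le_norm (curl (u t) x) (curl (f t) x)
      have h' := (le_abs_self _).trans h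
      nlinarith [sq_nonneg (‖curl (u t) x‖ - ‖curl (f t) x‖), norm_nonneg (curl (u t) x),
        norm_nonneg (curl (f t) x)]
    have hst := hstr t ht
    have hDnn : 0 ≤ ∫ x, frobeniusNormSq (fderiv ℝ (curl (u t)) x) :=
      integral_nonneg fun x => frobeniusNormSq_nonneg _
    have hΦt : Φ t = 2 * ∫ x, ⟪vort t x, W t x⟫ := by
      rw [hΦdef]
      exact integral_const_mul _ _
    rw [hΦt, hωt, hid]
    have hYt : Y t = ∫ x, ‖curl (u t) x‖ ^ 2 := rfl
    rw [hYt, hFdef]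
    show 2 * (-ν * (∫ x, frobeniusNormSq (fderiv ℝ (curl (u t)) x)) +
        (∫ x, ⟪curl (u t) x, fderiv ℝ (u t) x (curl (u t) x)⟫) + ∫ x, ⟪curl (u t) x, curl (f t) x⟫) ≤
      (α t + 1) * (∫ x, ‖curl (u t) x‖ ^ 2) + C₄ * (∫ x, frobeniusNormSq (fderiv ℝ (u t) x)) + G
    nlinarith [hst, hforce, hGreal t ht, hν, hDnn]
  -- Grönwall, lower-integral form
  set φ : ℝ → ℝ≥0∞ := fun t => ENNReal.ofReal (Y t) with hφdef
  set a : ℝ → ℝ≥0∞ := fun t => ENNReal.ofReal (α t + 1) with hadef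
  set Bg : ℝ≥0∞ := ENNReal.ofReal (Y 0 + C₄ * I + G * T'') with hBg
  have hineq : ∀ b ∈ Icc 0 T'', φ b ≤ Bg + ∫⁻ s in Ioo 0 b, a s * φ s := by
    intro b hb
    rcases eq_or_lt_of_le hb.1 with h0 | hb0
    · rw [← h0]
      simp only [Ioo_self, Measure.restrict_empty, lintegral_zero_measure, add_zero]
      rw [hφdef, hBg]
      exact ENNReal.ofReal_le_ofReal (by nlinarith [hY0 0, (G : ℝ≥0).coe_nonneg, hT''.le])
    have hbalb := hbal b ⟨hb0, hb.2⟩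
    -- `Y b = Y 0 + ∫₀ᵇ Φ`
    have hYb : Y b = Y 0 + ∫ t in Ioo 0 b, Φ t := by
      have h : (∫ x, ‖vort b x‖ ^ 2) = (∫ x, ‖vort 0 x‖ ^ 2) + ∫ t in (0 : ℝ)..b, Φ t := hbalb
      rw [intervalIntegral.integral_of_le hb0.le, integral_Ioc_eq_integral_Ioo] at h
      exact h
    -- pointwise bound on `(0, b)`
    have hpt : ∀ t ∈ Ioo 0 b, ENNReal.ofReal (Φ t) ≤
        a t * φ t + (ENNReal.ofReal C₄ * FE t + (G : ℝ≥0∞)) := by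
      intro t ht
      have htS : t ∈ Icc 0 T'' := ⟨ht.1.le, ht.2.le.trans hb.2⟩
      have hα1 : 0 ≤ α t + 1 := by linarith [hα t]
      rw [hadef, hφdef, ← ENNReal.ofReal_mul hα1, ← hFof t htS, ← ENNReal.ofReal_mul hC₄,
        ← ENNReal.ofReal_coe_nnreal, ← ENNReal.ofReal_add (mul_nonneg hC₄ (hF0 t)) (G.coe_nonneg),
        ← ENNReal.ofReal_add (mul_nonneg hα1 (hY0 t)) (add_nonneg (mul_nonneg hC₄ (hF0 t)) G.coe_nonneg)]
      exact ENNReal.ofReal_le_ofReal (by linarith [hslice t htS])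
    have hmeas : AEMeasurable (fun t => ENNReal.ofReal C₄ * FE t + (G : ℝ≥0∞))
        ((volume : Measure ℝ).restrict (Ioo 0 b)) := by
      have hFEb : AEMeasurable FE ((volume : Measure ℝ).restrict (Ioo 0 b)) :=
        hFEm.mono_measure (Measure.restrict_mono (Ioo_subset_Icc_self.trans (Icc_subset_Icc_right hb.2))
          le_rfl)
      exact (hFEb.const_mul _).add aemeasurable_const
    calc φ b = ENNReal.ofReal (Y 0 + ∫ t in Ioo 0 b, Φ t) := by
          show ENNReal.ofReal (Y b) = _
          rw [hYb]
      _ ≤ ENNReal.ofReal (Y 0) + ENNReal.ofReal (∫ t in Ioo 0 b, Φ t) := ENNReal.ofReal_add_le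
      _ ≤ ENNReal.ofReal (Y 0) + ∫⁻ t in Ioo 0 b, ENNReal.ofReal (Φ t) :=
          add_le_add le_rfl (ofReal_integral_le_lintegral_ofReal'' _)
      _ ≤ ENNReal.ofReal (Y 0) + ∫⁻ t in Ioo 0 b,
            (a t * φ t + (ENNReal.ofReal C₄ * FE t + (G : ℝ≥0∞))) :=
          add_le_add le_rfl (setLIntegral_mono' measurableSet_Ioo hpt)
      _ = ENNReal.ofReal (Y 0) + ((∫⁻ t in Ioo 0 b, a t * φ t) +
            ∫⁻ t in Ioo 0 b, (ENNReal.ofReal C₄ * FE t + (G : ℝ≥0∞))) := by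
          rw [lintegral_add_right' _ hmeas]
      _ ≤ ENNReal.ofReal (Y 0) + ((∫⁻ t in Ioo 0 b, a t * φ t) +
            (ENNReal.ofReal (C₄ * I) + ENNReal.ofReal (G * T''))) := by
          gcongr
          calc ∫⁻ t in Ioo 0 b, (ENNReal.ofReal C₄ * FE t + (G : ℝ≥0∞))
              = ENNReal.ofReal C₄ * (∫⁻ t in Ioo 0 b, FE t) + (G : ℝ≥0∞) * volume (Ioo (0 : ℝ) b) := by
                rw [lintegral_add_right' _ aemeasurable_const, lintegral_const_mul'' _
                  (hFEm.mono_measure (Measure.restrict_mono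
                    (Ioo_subset_Icc_self.trans (Icc_subset_Icc_right hb.2)) le_rfl)),
                  setLIntegral_const]
            _ ≤ ENNReal.ofReal C₄ * ENNReal.ofReal I + (G : ℝ≥0∞) * ENNReal.ofReal T'' := by
                gcongr
                · exact (lintegral_mono_set (Ioo_subset_Ioo le_rfl hb.2)).trans hIF
                · rw [Real.volume_Ioo, sub_zero]
                  exact ENNReal.ofReal_le_ofReal hb.2
            _ = ENNReal.ofReal (C₄ * I) + ENNReal.ofReal (G * T'') := by
                rw [ENNReal.ofReal_mul hC₄, ENNReal.ofReal_mul G.coe_nonneg, ENNReal.ofReal_coe_nnreal]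
      _ = Bg + ∫⁻ s in Ioo 0 b, a s * φ s := by
          rw [hBg, ENNReal.ofReal_add (by positivity) (by positivity),
            ENNReal.ofReal_add (hY0 0) (by positivity)]
          ring
  -- hypotheses of Grönwall
  have hBgtop : Bg ≠ ⊤ := ENNReal.ofReal_ne_top
  have hφM : ∀ t ∈ Icc 0 T'', φ t ≤ V₀ := fun t ht => hYV t ht
  have haT : ∫⁻ t in Ioo 0 T'', a t = (∫⁻ t in Ioo 0 T'', ENNReal.ofReal (α t)) + ENNReal.ofReal T'' := by
    rw [hadef]
    simp only
    have : ∀ t, ENNReal.ofReal (α t + 1) = ENNReal.ofReal (α t) + 1 := fun t => by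
      rw [ENNReal.ofReal_add (hα t) zero_le_one, ENNReal.ofReal_one]
    simp_rw [this]
    rw [lintegral_add_right' _ aemeasurable_const, setLIntegral_const, Real.volume_Ioo, sub_zero, one_mul]
  have hatop : ∫⁻ t in Ioo 0 T'', a t ≠ ⊤ := by
    rw [haT]
    exact ENNReal.add_ne_top.2 ⟨hαT, ENNReal.ofReal_ne_top⟩
  have hgron := lintegral_gronwall_le hBgtop hV₀top.ne hφM hatop hineq
  -- the exponent
  have hexp : ∀ t ∈ Icc 0 T'', (∫⁻ s in Ioo 0 t, a s).toReal ≤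
      (∫⁻ s in Ioo 0 T'', ENNReal.ofReal (α s)).toReal + T'' := by
    intro t ht
    have h1 : ∫⁻ s in Ioo 0 t, a s ≤ ∫⁻ s in Ioo 0 T'', a s := lintegral_mono_set (Ioo_subset_Ioo le_rfl ht.2)
    have h2 := ENNReal.toReal_mono hatop h1
    rw [haT, ENNReal.toReal_add hαT ENNReal.ofReal_ne_top, ENNReal.toReal_ofReal hT''.le] at h2
    exact h2
  -- conclusion
  intro t ht
  have hg := hgron t ht
  have hfinal : φ t ≤ ENNReal.ofReal (((∫ x, ‖curl (u 0) x‖ ^ 2) + C₄ * I + G * T'') *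
      Real.exp ((∫⁻ s in Ioo 0 T'', ENNReal.ofReal (α s)).toReal + T'')) := by
    refine hg.trans ?_
    rw [hBg, ← ENNReal.ofReal_mul (by positivity)]
    refine ENNReal.ofReal_le_ofReal (mul_le_mul_of_nonneg_left ?_ (by positivity))
    exact Real.exp_le_exp.2 (hexp t ht)
  have := (ENNReal.ofReal_le_ofReal_iff (by positivity)).1 hfinal
  exact this

/-! ### §3 Beale–Kato–Majda with a force, `H¹` form -/

set_option maxHeartbeats 800000 in
/-- **BEALE–KATO–MAJDA WITH A FORCE, `H¹` FORM** (Beale–Kato–Majda 1984, Thm. 1; Majda–Bertozzi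
2002, Thm. 3.6, (3.80)–(3.82) and the remark p. 117 that the proof applies equally to
Navier–Stokes, `ν > 0`; here with a force). Let `(u, p)` be a classical solution of the FORCED
Navier–Stokes system on `[0, T''] × ℝ³`, `ν > 0`, with all `L²` Sobolev seminorms of `u` bounded
there and `∫|curl f(t)|² ≤ G` on `[0, T'']`. If `A = ∫₀^{T''} ‖curl u(t)‖_{L^∞} dt < ∞` (lower
integral of the `ℝ≥0∞`-valued supremum), then for every `t ∈ [0, T'']`
`∫|curl u(t)|² ≤ (∫|curl u(0)|² + G T'') exp(2A + T'')`.
Proof: `sq_norm_curl_le_of_stretching_forced` with `α(t) = 2‖ω(t)‖_∞`, `C₄ = 0`: pointwise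
`⟪ω, (∇u)ω⟫ ≤ ‖ω‖_∞ ‖∇u‖ |ω| ≤ ‖ω‖_∞ (‖∇u‖² + |ω|²)/2` and the `div`–`curl` estimate
`∫|∇u|² ≤ ∫|ω|²` (`lintegral_frobeniusNormSq_fderiv_le_lintegral_sq_norm_curl`).
[cite: BealeKatoMajda1984, Theorem 1] [cite: MajdaBertozzi2002, Thm. 3.6 proof, (3.80)-(3.82), remark p. 117] -/
theorem sq_norm_curl_le_of_vorticity_sup_forced {ν T'' : ℝ} (hν : 0 < ν) (hT'' : 0 < T'')
    {f u : ℝ → EuclideanSpace ℝ (Fin 3) → EuclideanSpace ℝ (Fin 3)}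
    {p : ℝ → EuclideanSpace ℝ (Fin 3) → ℝ} (hS : IsClassicalNSSolutionOn (Icc 0 T'') ν f u p)
    (hB : HasBoundedSobolevNormsOn (Icc 0 T'') u)
    {G : ℝ≥0} (hG : ∀ t ∈ Icc 0 T'', ∫⁻ x, ‖curl (f t) x‖ₑ ^ 2 ≤ G)
    (hA : ∫⁻ t in Ioo 0 T'', (⨆ x, ‖curl (u t) x‖ₑ) ≠ ⊤) :
    ∀ t ∈ Icc 0 T'', ∫ x, ‖curl (u t) x‖ ^ 2 ≤
      ((∫ x, ‖curl (u 0) x‖ ^ 2) + G * T'') *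
        Real.exp (2 * (∫⁻ t in Ioo 0 T'', ⨆ x, ‖curl (u t) x‖ₑ).toReal + T'') := by
  have hU : UniqueDiffOn ℝ (Icc 0 T'') := uniqueDiffOn_Icc hT''
  set κ : ℝ := ‖curlCLM‖ with hκ
  have hsm : ∀ t ∈ Icc 0 T'', ContDiff ℝ ∞ (u t) := fun t ht => hS.contDiff_velocity ht
  have hsm3 : ∀ t ∈ Icc 0 T'', ContDiff ℝ 3 (u t) := fun t ht => (hsm t ht).of_le (by norm_cast)
  have hsm2 : ∀ t ∈ Icc 0 T'', ContDiff ℝ 2 (u t) := fun t ht => (hsm t ht).of_le (by norm_cast)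
  obtain ⟨B₁, hB₁0, hB₁⟩ := exists_forall_norm_fderiv_le_of_hasBoundedSobolevNormsOn hsm3 hB
  have hfin : ∀ n, ∀ t ∈ Icc 0 T'', ∫⁻ x, ‖iteratedFDeriv ℝ n (u t) x‖ₑ ^ 2 < ⊤ := fun n t ht => by
    obtain ⟨C, hC⟩ := hB n
    exact (hC t ht).trans_lt ENNReal.coe_lt_top
  obtain ⟨C₁', hC₁'⟩ := hB 1
  -- the supremum is finite on the slab, and dominates pointwise
  set M : ℝ → ℝ≥0∞ := fun t => ⨆ x, ‖curl (u t) x‖ₑ with hMdef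
  have hMle : ∀ t ∈ Icc 0 T'', M t ≤ ENNReal.ofReal (κ * B₁) := by
    intro t ht
    refine iSup_le fun x => ?_
    rw [← ofReal_norm]
    exact ENNReal.ofReal_le_ofReal ((norm_curl_le (u t) x).trans
      (mul_le_mul_of_nonneg_left (hB₁ t ht x) (norm_nonneg _)))
  have hMtop : ∀ t ∈ Icc 0 T'', M t ≠ ⊤ := fun t ht =>
    ne_top_of_le_ne_top ENNReal.ofReal_ne_top (hMle t ht)
  have hMx : ∀ t ∈ Icc 0 T'', ∀ x, ‖curl (u t) x‖ ≤ (M t).toReal := by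
    intro t ht x
    refine (ENNReal.ofReal_le_iff_le_toReal (hMtop t ht)).1 ?_
    rw [ofReal_norm]
    exact le_iSup (fun y => ‖curl (u t) y‖ₑ) x
  -- the Grönwall coefficient
  set α : ℝ → ℝ := fun t => 2 * (M t).toReal with hαdef
  have hα : ∀ t, 0 ≤ α t := fun t => by positivity
  have hαle : ∫⁻ t in Ioo 0 T'', ENNReal.ofReal (α t) ≤ 2 * ∫⁻ t in Ioo 0 T'', M t := by
    rw [← lintegral_const_mul' _ _ (by norm_num : (2 : ℝ≥0∞) ≠ ⊤)]
    refine lintegral_mono fun t => ?_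
    rw [hαdef]
    show ENNReal.ofReal (2 * (M t).toReal) ≤ 2 * M t
    rw [ENNReal.ofReal_mul zero_le_two, ENNReal.ofReal_ofNat]
    exact mul_le_mul' le_rfl ENNReal.ofReal_toReal_le
  have hαT : ∫⁻ t in Ioo 0 T'', ENNReal.ofReal (α t) ≠ ⊤ :=
    ne_top_of_le_ne_top (ENNReal.mul_ne_top (by norm_num) hA) hαle
  -- a dissipation bound on the slab (any finite one will do: `C₄ = 0`)
  set FE : ℝ → ℝ≥0∞ := fun t => ∫⁻ x, ENNReal.ofReal (frobeniusNormSq (fderiv ℝ (u t) x)) with hFEdef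
  have hFEle : ∀ t ∈ Icc 0 T'', FE t ≤ 3 * (C₁' : ℝ≥0∞) := by
    intro t ht
    calc FE t ≤ ∫⁻ x, 3 * ‖fderiv ℝ (u t) x‖ₑ ^ 2 :=
          lintegral_mono fun x => ofReal_frobeniusNormSq_le_three_mul_enorm_sq _
      _ = 3 * ∫⁻ x, ‖iteratedFDeriv ℝ 1 (u t) x‖ₑ ^ 2 := by
          rw [lintegral_const_mul' _ _ (by norm_num)]
          congr 1
          exact lintegral_congr fun x => by rw [← ofReal_norm, ← norm_iteratedFDeriv_one, ofReal_norm]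
      _ ≤ 3 * (C₁' : ℝ≥0∞) := mul_le_mul' le_rfl (hC₁' t ht)
  set IE : ℝ≥0∞ := 3 * (C₁' : ℝ≥0∞) * ENNReal.ofReal T'' with hIE
  have hIEtop : IE ≠ ⊤ :=
    ENNReal.mul_ne_top (ENNReal.mul_ne_top (by norm_num) ENNReal.coe_ne_top) ENNReal.ofReal_ne_top
  have hdiss : ∫⁻ t in Ioo 0 T'', FE t ≤ ENNReal.ofReal IE.toReal := by
    rw [ENNReal.ofReal_toReal hIEtop]
    calc ∫⁻ t in Ioo 0 T'', FE t ≤ ∫⁻ _ in Ioo 0 T'', 3 * (C₁' : ℝ≥0∞) :=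
          setLIntegral_mono' measurableSet_Ioo fun t ht => hFEle t ⟨ht.1.le, ht.2.le⟩
      _ = IE := by rw [setLIntegral_const, Real.volume_Ioo, sub_zero, hIE]
  -- the stretching bound with `α = 2‖ω‖_∞`, `C₄ = 0`
  have hstr : ∀ t ∈ Icc 0 T'',
      2 * ∫ x, ⟪curl (u t) x, fderiv ℝ (u t) x (curl (u t) x)⟫ ≤
        ν * (∫ x, frobeniusNormSq (fderiv ℝ (curl (u t)) x)) +
          α t * (∫ x, ‖curl (u t) x‖ ^ 2) + 0 * (∫ x, frobeniusNormSq (fderiv ℝ (u t) x)) := by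
    intro t ht
    have hv := hsm3 t ht
    have hv2 := hsm2 t ht
    have hw1 : ContDiff ℝ 1 (curl (u t)) := contDiff_curl (n := 1) (by exact hv2)
    have cw : Continuous (curl (u t)) := hw1.continuous
    have cDv : Continuous (fderiv ℝ (u t)) := hv.continuous_fderiv (by norm_num)
    set Mr : ℝ := (M t).toReal with hMr
    have hMr0 : 0 ≤ Mr := ENNReal.toReal_nonneg
    -- `L²` facts
    have l2w : ∫⁻ x, ‖curl (u t) x‖ₑ ^ 2 < ⊤ := by
      refine lintegral_enorm_sq_lt_top_of_norm_le (b := fun x => (κ : ℝ) • iteratedFDeriv ℝ 1 (u t) x)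
        (fun x => ?_) (lintegral_enorm_sq_const_smul_lt_top _ (hfin 1 t ht))
      rw [norm_smul, Real.norm_of_nonneg (norm_nonneg _), norm_iteratedFDeriv_one]
      exact norm_curl_le (u t) x
    have l2Dv : ∫⁻ x, ‖fderiv ℝ (u t) x‖ₑ ^ 2 < ⊤ := by
      refine lt_of_le_of_lt (le_of_eq (lintegral_congr fun x => ?_)) (hfin 1 t ht)
      rw [← ofReal_norm, ← ofReal_norm, norm_iteratedFDeriv_one]
    have l2u : ∫⁻ x, ‖u t x‖ₑ ^ 2 < ⊤ := by
      refine lt_of_le_of_lt (le_of_eq (lintegral_congr fun x => ?_)) (hfin 0 t ht)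
      rw [← ofReal_norm, ← ofReal_norm, norm_iteratedFDeriv_zero]
    have iY : Integrable fun x => ‖curl (u t) x‖ ^ 2 := integrable_sq_norm_of_lintegral_lt_top cw l2w
    have iD : Integrable fun x => ‖fderiv ℝ (u t) x‖ ^ 2 := integrable_sq_norm_of_lintegral_lt_top cDv l2Dv
    have iF : Integrable fun x => frobeniusNormSq (fderiv ℝ (u t) x) := by
      have hlt : ∫⁻ x, ENNReal.ofReal (frobeniusNormSq (fderiv ℝ (u t) x)) < ⊤ :=
        (hFEle t ht).trans_lt (ENNReal.mul_lt_top (by norm_num) ENNReal.coe_lt_top)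
      exact integrable_of_continuous_of_nonneg (continuous_frobeniusNormSq_fderiv hv2 (by simp))
        (fun x => frobeniusNormSq_nonneg _) hlt
    have iS : Integrable (fun x => ⟪curl (u t) x, fderiv ℝ (u t) x (curl (u t) x)⟫) volume := by
      refine (iY.const_mul B₁).mono' (cw.inner (cDv.clm_apply cw)).aestronglyMeasurable
        (Eventually.of_forall fun x => ?_)
      rw [Real.norm_eq_abs]
      calc |⟪curl (u t) x, fderiv ℝ (u t) x (curl (u t) x)⟫|
          ≤ ‖curl (u t) x‖ * ‖fderiv ℝ (u t) x (curl (u t) x)‖ := abs_real_inner_le_norm _ _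
        _ ≤ ‖curl (u t) x‖ * (‖fderiv ℝ (u t) x‖ * ‖curl (u t) x‖) :=
            mul_le_mul_of_nonneg_left (ContinuousLinearMap.le_opNorm _ _) (norm_nonneg _)
        _ ≤ ‖curl (u t) x‖ * (B₁ * ‖curl (u t) x‖) := by
            gcongr
            exact hB₁ t ht x
        _ = B₁ * ‖curl (u t) x‖ ^ 2 := by ring
    -- pointwise: `⟪ω, (∇u)ω⟫ ≤ ‖ω‖_∞ (‖∇u‖² + |ω|²)/2`
    have hpt : ∀ x, ⟪curl (u t) x, fderiv ℝ (u t) x (curl (u t) x)⟫ ≤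
        Mr / 2 * ‖fderiv ℝ (u t) x‖ ^ 2 + Mr / 2 * ‖curl (u t) x‖ ^ 2 := by
      intro x
      have h1 : ⟪curl (u t) x, fderiv ℝ (u t) x (curl (u t) x)⟫ ≤
          ‖curl (u t) x‖ * (‖fderiv ℝ (u t) x‖ * ‖curl (u t) x‖) :=
        (le_abs_self _).trans ((abs_real_inner_le_norm _ _).trans
          (mul_le_mul_of_nonneg_left (ContinuousLinearMap.le_opNorm _ _) (norm_nonneg _)))
      have h2 : ‖curl (u t) x‖ * (‖fderiv ℝ (u t) x‖ * ‖curl (u t) x‖) ≤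
          Mr * (‖fderiv ℝ (u t) x‖ * ‖curl (u t) x‖) :=
        mul_le_mul_of_nonneg_right (hMx t ht x) (by positivity)
      nlinarith [h1, h2, sq_nonneg (‖fderiv ℝ (u t) x‖ - ‖curl (u t) x‖), hMr0]
    have hS1 : ∫ x, ⟪curl (u t) x, fderiv ℝ (u t) x (curl (u t) x)⟫ ≤
        Mr / 2 * (∫ x, ‖fderiv ℝ (u t) x‖ ^ 2) + Mr / 2 * (∫ x, ‖curl (u t) x‖ ^ 2) := by
      rw [← integral_const_mul, ← integral_const_mul, ← integral_add (iD.const_mul _) (iY.const_mul _)]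
      exact integral_mono iS ((iD.const_mul _).add (iY.const_mul _)) hpt
    -- `∫‖∇u‖² ≤ ∫|∇u|²_F ≤ ∫|ω|²`
    have hDF : ∫ x, ‖fderiv ℝ (u t) x‖ ^ 2 ≤ ∫ x, frobeniusNormSq (fderiv ℝ (u t) x) :=
      integral_mono iD iF fun x => sq_opNorm_le_frobeniusNormSq _
    have hFY : ∫ x, frobeniusNormSq (fderiv ℝ (u t) x) ≤ ∫ x, ‖curl (u t) x‖ ^ 2 := by
      have h := lintegral_frobeniusNormSq_fderiv_le_lintegral_sq_norm_curl hv2 (hS.divFree t ht) l2u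
      rw [← ofReal_integral_eq_lintegral_ofReal iF (Eventually.of_forall fun x => frobeniusNormSq_nonneg _)]
        at h
      have h' : ENNReal.ofReal (∫ x, frobeniusNormSq (fderiv ℝ (u t) x)) ≤
          ENNReal.ofReal (∫ x, ‖curl (u t) x‖ ^ 2) := by
        refine h.trans (le_of_eq ?_)
        rw [ofReal_integral_eq_lintegral_ofReal iY (Eventually.of_forall fun x => sq_nonneg _)]
        exact lintegral_congr fun x => by rw [← ofReal_norm, ENNReal.ofReal_pow (norm_nonneg _)]
      exact (ENNReal.ofReal_le_ofReal_iff (integral_nonneg fun x => sq_nonneg _)).1 h'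
    have hDnn : 0 ≤ ∫ x, frobeniusNormSq (fderiv ℝ (curl (u t)) x) :=
      integral_nonneg fun x => frobeniusNormSq_nonneg _
    have hαt : α t = 2 * Mr := rfl
    have hY0' : 0 ≤ ∫ x, ‖curl (u t) x‖ ^ 2 := integral_nonneg fun x => sq_nonneg _
    rw [hαt, zero_mul, add_zero]
    nlinarith [hS1, hDF, hFY, hν, hDnn, hMr0, hY0']
  -- Grönwall
  have hmain := sq_norm_curl_le_of_stretching_forced hν hT'' hS hB hG ENNReal.toReal_nonneg hdiss hα hαT
    le_rfl hstr
  intro t ht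
  refine (hmain t ht).trans ?_
  rw [zero_mul, add_zero]
  refine mul_le_mul_of_nonneg_left (Real.exp_le_exp.2 ?_) (by positivity)
  have h2 : (∫⁻ s in Ioo 0 T'', ENNReal.ofReal (α s)).toReal ≤
      2 * (∫⁻ t in Ioo 0 T'', M t).toReal := by
    have := ENNReal.toReal_mono (ENNReal.mul_ne_top (by norm_num) hA) hαle
    rwa [ENNReal.toReal_mul, ENNReal.toReal_ofNat] at this
  linarith

/-- **Beale–Kato–Majda with a force: the enstrophy form.** Under the hypotheses of
`sq_norm_curl_le_of_vorticity_sup_forced`, for every `t ∈ [0, T'']`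
`∫|∇u(t)|²_F ≤ (∫|curl u(0)|² + G T'') exp(2∫₀^{T''}‖curl u‖_∞ + T'')` (the `div`–`curl` estimate
`∫|∇u|² ≤ ∫|ω|²`). [cite: BealeKatoMajda1984, Theorem 1] [cite: MajdaBertozzi2002, Thm. 3.6 proof, (3.80)-(3.82)] -/
theorem lintegral_frobeniusNormSq_le_of_vorticity_sup_forced {ν T'' : ℝ} (hν : 0 < ν) (hT'' : 0 < T'')
    {f u : ℝ → EuclideanSpace ℝ (Fin 3) → EuclideanSpace ℝ (Fin 3)}
    {p : ℝ → EuclideanSpace ℝ (Fin 3) → ℝ} (hS : IsClassicalNSSolutionOn (Icc 0 T'') ν f u p)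
    (hB : HasBoundedSobolevNormsOn (Icc 0 T'') u)
    {G : ℝ≥0} (hG : ∀ t ∈ Icc 0 T'', ∫⁻ x, ‖curl (f t) x‖ₑ ^ 2 ≤ G)
    (hA : ∫⁻ t in Ioo 0 T'', (⨆ x, ‖curl (u t) x‖ₑ) ≠ ⊤) :
    ∀ t ∈ Icc 0 T'', ∫⁻ x, ENNReal.ofReal (frobeniusNormSq (fderiv ℝ (u t) x)) ≤
      ENNReal.ofReal (((∫ x, ‖curl (u 0) x‖ ^ 2) + G * T'') *
        Real.exp (2 * (∫⁻ t in Ioo 0 T'', ⨆ x, ‖curl (u t) x‖ₑ).toReal + T'')) := by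
  intro t ht
  have hY := sq_norm_curl_le_of_vorticity_sup_forced hν hT'' hS hB hG hA t ht
  have hv2 : ContDiff ℝ 2 (u t) := (hS.contDiff_velocity ht).of_le (by norm_cast)
  obtain ⟨C₀, hC₀⟩ := hB 0
  obtain ⟨C₁, hC₁⟩ := hB 1
  have l2u : ∫⁻ x, ‖u t x‖ₑ ^ 2 < ⊤ := by
    refine lt_of_le_of_lt (le_of_eq (lintegral_congr fun x => ?_)) ((hC₀ t ht).trans_lt ENNReal.coe_lt_top)
    rw [← ofReal_norm, ← ofReal_norm, norm_iteratedFDeriv_zero]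
  have cw : Continuous (curl (u t)) := (contDiff_curl (n := 1) (by exact hv2)).continuous
  have l2w : ∫⁻ x, ‖curl (u t) x‖ₑ ^ 2 < ⊤ :=
    (lintegral_curl_sq_le (u t)).trans_lt
      (ENNReal.mul_lt_top ENNReal.ofReal_lt_top ((hC₁ t ht).trans_lt ENNReal.coe_lt_top))
  have iY : Integrable fun x => ‖curl (u t) x‖ ^ 2 := integrable_sq_norm_of_lintegral_lt_top cw l2w
  calc ∫⁻ x, ENNReal.ofReal (frobeniusNormSq (fderiv ℝ (u t) x))
      ≤ ∫⁻ x, ‖curl (u t) x‖ₑ ^ 2 :=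
        lintegral_frobeniusNormSq_fderiv_le_lintegral_sq_norm_curl hv2 (hS.divFree t ht) l2u
    _ = ENNReal.ofReal (∫ x, ‖curl (u t) x‖ ^ 2) := by
        rw [ofReal_integral_eq_lintegral_ofReal iY (Eventually.of_forall fun x => sq_nonneg _)]
        exact lintegral_congr fun x => by rw [← ofReal_norm, ENNReal.ofReal_pow (norm_nonneg _)]
    _ ≤ _ := ENNReal.ofReal_le_ofReal hY

/-! ### §4 Constantin–Fefferman with a force -/

/-- **The Constantin–Fefferman enstrophy bound on a closed slab, WITH A FORCE** (the forced twin of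
the tree's `integral_sq_norm_curl_le_of_direction_slab`; Constantin–Fefferman 1993, §2;
Lemarié-Rieusset 2016, end of the proof of Thm. 11.7). Let `(u, p)` be a classical solution of the
FORCED Navier–Stokes system on `[0, T''] × ℝ³`, `ν > 0`, with all `L²` Sobolev seminorms of `u`
bounded there, energy `‖u(t)‖²₂ ≤ Ē`, dissipation `∫₀^{T''}∫|∇u|² ≤ I`, `∫|curl f(t)|² ≤ G`, and
assume the stretching estimate in Constantin–Fefferman's shape with constants `C₁, …, C₄ ≥ 0` (as
supplied at each time by the purely spatial `exists_two_mul_integral_stretching_le` under the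
direction hypothesis on `{|ω| > Ω}`). Then for all `t ∈ [0, T'']`
`∫|ω(t)|² ≤ (∫|ω(0)|² + C₄ I + G T'') exp((C₁ + C₃Ē + 1)T'' + C₂‖curl‖² I)`.
[cite: ConstantinFeffermanIndiana1993, §2 (the enstrophy bound)] [cite: LemarieRieusset2016, Thm. 11.7 (proof)] -/
theorem sq_norm_curl_le_of_direction_slab_forced {ν T'' : ℝ} (hν : 0 < ν) (hT'' : 0 < T'')
    {f u : ℝ → EuclideanSpace ℝ (Fin 3) → EuclideanSpace ℝ (Fin 3)}
    {p : ℝ → EuclideanSpace ℝ (Fin 3) → ℝ} (hS : IsClassicalNSSolutionOn (Icc 0 T'') ν f u p)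
    (hB : HasBoundedSobolevNormsOn (Icc 0 T'') u)
    {G : ℝ≥0} (hG : ∀ t ∈ Icc 0 T'', ∫⁻ x, ‖curl (f t) x‖ₑ ^ 2 ≤ G)
    {Ē I : ℝ} (hĒ : 0 ≤ Ē) (hI : 0 ≤ I)
    (hen : ∀ t ∈ Icc 0 T'', ∫⁻ x, ‖u t x‖ₑ ^ 2 ≤ ENNReal.ofReal Ē)
    (hdiss : ∫⁻ t in Ioo 0 T'', ∫⁻ x, ENNReal.ofReal (frobeniusNormSq (fderiv ℝ (u t) x)) ≤
      ENNReal.ofReal I)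
    {C₁ C₂ C₃ C₄ : ℝ} (hC₁ : 0 ≤ C₁) (hC₂ : 0 ≤ C₂) (hC₃ : 0 ≤ C₃) (hC₄ : 0 ≤ C₄)
    (hstr : ∀ t ∈ Icc 0 T'',
      2 * ∫ x, ⟪curl (u t) x, fderiv ℝ (u t) x (curl (u t) x)⟫ ≤
        ν * (∫ x, frobeniusNormSq (fderiv ℝ (curl (u t)) x)) +
          (C₁ + C₂ * (∫ x, ‖curl (u t) x‖ ^ 2) + C₃ * (∫ x, ‖u t x‖ ^ 2)) *
            (∫ x, ‖curl (u t) x‖ ^ 2) +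
          C₄ * (∫ x, frobeniusNormSq (fderiv ℝ (u t) x))) :
    ∀ t ∈ Icc 0 T'', ∫ x, ‖curl (u t) x‖ ^ 2 ≤
      ((∫ x, ‖curl (u 0) x‖ ^ 2) + C₄ * I + G * T'') *
        Real.exp ((C₁ + C₃ * Ē + 1) * T'' + C₂ * (‖curlCLM‖ ^ 2 * I)) := by
  set κ : ℝ := ‖curlCLM‖ with hκ
  have hsm : ∀ t ∈ Icc 0 T'', ContDiff ℝ ∞ (u t) := fun t ht => hS.contDiff_velocity ht
  have hsm2 : ∀ t ∈ Icc 0 T'', ContDiff ℝ 2 (u t) := fun t ht => (hsm t ht).of_le (by norm_cast)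
  have hfin : ∀ n, ∀ t ∈ Icc 0 T'', ∫⁻ x, ‖iteratedFDeriv ℝ n (u t) x‖ₑ ^ 2 < ⊤ := fun n t ht => by
    obtain ⟨C, hC⟩ := hB n
    exact (hC t ht).trans_lt ENNReal.coe_lt_top
  -- the quantities
  set Y : ℝ → ℝ := fun t => ∫ x, ‖curl (u t) x‖ ^ 2 with hYdef
  set F : ℝ → ℝ := fun t => ∫ x, frobeniusNormSq (fderiv ℝ (u t) x) with hFdef
  have hY0 : ∀ t, 0 ≤ Y t := fun t => integral_nonneg fun x => sq_nonneg _
  have hF0 : ∀ t, 0 ≤ F t := fun t => integral_nonneg fun x => frobeniusNormSq_nonneg _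
  -- real energy bound
  have hEreal : ∀ t ∈ Icc 0 T'', ∫ x, ‖u t x‖ ^ 2 ≤ Ē := by
    intro t ht
    have h := integral_sq_norm_le_toReal (hsm t ht).continuous ENNReal.ofReal_ne_top (hen t ht)
    rwa [ENNReal.toReal_ofReal hĒ] at h
  -- integrability of `|∇u(t)|²_F`, `F` versus the dissipation, `Y ≤ κ² F`
  have hFint : ∀ t ∈ Icc 0 T'', Integrable fun x => frobeniusNormSq (fderiv ℝ (u t) x) := by
    intro t ht
    have hlt : ∫⁻ x, ENNReal.ofReal (frobeniusNormSq (fderiv ℝ (u t) x)) < ⊤ := by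
      calc ∫⁻ x, ENNReal.ofReal (frobeniusNormSq (fderiv ℝ (u t) x))
          ≤ ∫⁻ x, 3 * ‖fderiv ℝ (u t) x‖ₑ ^ 2 :=
            lintegral_mono fun x => ofReal_frobeniusNormSq_le_three_mul_enorm_sq _
        _ = 3 * ∫⁻ x, ‖iteratedFDeriv ℝ 1 (u t) x‖ₑ ^ 2 := by
            rw [lintegral_const_mul' _ _ (by norm_num)]
            congr 1
            exact lintegral_congr fun x => by rw [← ofReal_norm, ← norm_iteratedFDeriv_one, ofReal_norm]
        _ < ⊤ := ENNReal.mul_lt_top (by norm_num) (hfin 1 t ht)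
    exact integrable_of_continuous_of_nonneg (continuous_frobeniusNormSq_fderiv (hsm2 t ht) (by simp))
      (fun x => frobeniusNormSq_nonneg _) hlt
  have hFof : ∀ t ∈ Icc 0 T'', ENNReal.ofReal (F t) =
      ∫⁻ x, ENNReal.ofReal (frobeniusNormSq (fderiv ℝ (u t) x)) := fun t ht =>
    ofReal_integral_eq_lintegral_ofReal (hFint t ht) (Eventually.of_forall fun x => frobeniusNormSq_nonneg _)
  have hIF : ∫⁻ t in Ioo 0 T'', ENNReal.ofReal (F t) ≤ ENNReal.ofReal I := by
    refine le_trans (le_of_eq ?_) hdiss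
    exact setLIntegral_congr_fun measurableSet_Ioo fun t ht => hFof t ⟨ht.1.le, ht.2.le⟩
  have hYle : ∀ t ∈ Icc 0 T'', Y t ≤ κ ^ 2 * F t := by
    intro t ht
    have cw : Continuous (curl (u t)) := (contDiff_curl (n := 1) (by exact hsm2 t ht)).continuous
    have l2w : ∫⁻ x, ‖curl (u t) x‖ₑ ^ 2 < ⊤ :=
      (lintegral_curl_sq_le (u t)).trans_lt (ENNReal.mul_lt_top ENNReal.ofReal_lt_top (hfin 1 t ht))
    have hi : Integrable fun x => ‖curl (u t) x‖ ^ 2 := integrable_sq_norm_of_lintegral_lt_top cw l2w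
    rw [hYdef, hFdef]
    show (∫ x, ‖curl (u t) x‖ ^ 2) ≤ κ ^ 2 * ∫ x, frobeniusNormSq (fderiv ℝ (u t) x)
    rw [← integral_const_mul]
    refine integral_mono hi ((hFint t ht).const_mul _) fun x => ?_
    show ‖curl (u t) x‖ ^ 2 ≤ κ ^ 2 * frobeniusNormSq (fderiv ℝ (u t) x)
    calc ‖curl (u t) x‖ ^ 2 ≤ (κ * ‖fderiv ℝ (u t) x‖) ^ 2 :=
          pow_le_pow_left₀ (norm_nonneg _) (norm_curl_le _ _) 2
      _ = κ ^ 2 * ‖fderiv ℝ (u t) x‖ ^ 2 := by ring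
      _ ≤ κ ^ 2 * frobeniusNormSq (fderiv ℝ (u t) x) :=
          mul_le_mul_of_nonneg_left (sq_opNorm_le_frobeniusNormSq _) (sq_nonneg _)
  -- the Grönwall coefficient
  set α : ℝ → ℝ := fun t => C₁ + C₂ * Y t + C₃ * Ē with hαdef
  have hα : ∀ t, 0 ≤ α t := fun t => by positivity
  have hαbound : ∫⁻ s in Ioo 0 T'', ENNReal.ofReal (α s) ≤
      ENNReal.ofReal ((C₁ + C₃ * Ē) * T'' + C₂ * (κ ^ 2 * I)) := by
    have hsplit : ∀ s ∈ Ioo 0 T'', ENNReal.ofReal (α s) ≤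
        ENNReal.ofReal (C₁ + C₃ * Ē) + ENNReal.ofReal (C₂ * κ ^ 2) * ENNReal.ofReal (F s) := by
      intro s hs
      have hsS : s ∈ Icc 0 T'' := ⟨hs.1.le, hs.2.le⟩
      have hκ0 : 0 ≤ C₂ * κ ^ 2 := mul_nonneg hC₂ (sq_nonneg _)
      have hc13 : 0 ≤ C₁ + C₃ * Ē := by positivity
      rw [← ENNReal.ofReal_mul hκ0, ← ENNReal.ofReal_add hc13 (mul_nonneg hκ0 (hF0 s))]
      refine ENNReal.ofReal_le_ofReal ?_
      show C₁ + C₂ * Y s + C₃ * Ē ≤ C₁ + C₃ * Ē + C₂ * κ ^ 2 * F s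
      nlinarith [hYle s hsS, hC₂]
    have h2 : ∫⁻ s in Ioo 0 T'', ENNReal.ofReal (α s) ≤
        ENNReal.ofReal (C₁ + C₃ * Ē) * volume (Ioo (0 : ℝ) T'') +
          ENNReal.ofReal (C₂ * κ ^ 2) * ENNReal.ofReal I := by
      calc ∫⁻ s in Ioo 0 T'', ENNReal.ofReal (α s) ≤ ∫⁻ s in Ioo 0 T'', (ENNReal.ofReal (C₁ + C₃ * Ē) +
            ENNReal.ofReal (C₂ * κ ^ 2) * ENNReal.ofReal (F s)) := setLIntegral_mono' measurableSet_Ioo hsplit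
        _ = ENNReal.ofReal (C₁ + C₃ * Ē) * volume (Ioo (0 : ℝ) T'') +
            ENNReal.ofReal (C₂ * κ ^ 2) * ∫⁻ s in Ioo 0 T'', ENNReal.ofReal (F s) := by
            rw [lintegral_add_left measurable_const, setLIntegral_const,
              lintegral_const_mul' _ _ ENNReal.ofReal_ne_top]
        _ ≤ _ := add_le_add le_rfl (mul_le_mul' le_rfl hIF)
    have h3 : (ENNReal.ofReal (C₁ + C₃ * Ē) * volume (Ioo (0 : ℝ) T'') +
        ENNReal.ofReal (C₂ * κ ^ 2) * ENNReal.ofReal I) =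
        ENNReal.ofReal ((C₁ + C₃ * Ē) * T'' + C₂ * (κ ^ 2 * I)) := by
      rw [Real.volume_Ioo, sub_zero, ← ENNReal.ofReal_mul (by positivity), ← ENNReal.ofReal_mul (by positivity),
        ← ENNReal.ofReal_add (by positivity) (by positivity)]
      ring_nf
    exact h2.trans_eq h3
  have hαT : ∫⁻ s in Ioo 0 T'', ENNReal.ofReal (α s) ≠ ⊤ :=
    ne_top_of_le_ne_top ENNReal.ofReal_ne_top hαbound
  -- the stretching bound in the abstract shape
  have hstr' : ∀ t ∈ Icc 0 T'',
      2 * ∫ x, ⟪curl (u t) x, fderiv ℝ (u t) x (curl (u t) x)⟫ ≤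
        ν * (∫ x, frobeniusNormSq (fderiv ℝ (curl (u t)) x)) +
          α t * (∫ x, ‖curl (u t) x‖ ^ 2) + C₄ * (∫ x, frobeniusNormSq (fderiv ℝ (u t) x)) := by
    intro t ht
    have hst := hstr t ht
    have hY0' : 0 ≤ ∫ x, ‖curl (u t) x‖ ^ 2 := integral_nonneg fun x => sq_nonneg _
    have hmono : (C₁ + C₂ * (∫ x, ‖curl (u t) x‖ ^ 2) + C₃ * (∫ x, ‖u t x‖ ^ 2)) *
        (∫ x, ‖curl (u t) x‖ ^ 2) ≤
        (C₁ + C₂ * (∫ x, ‖curl (u t) x‖ ^ 2) + C₃ * Ē) * (∫ x, ‖curl (u t) x‖ ^ 2) := by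
      gcongr
      exact hEreal t ht
    have hαt : α t = C₁ + C₂ * (∫ x, ‖curl (u t) x‖ ^ 2) + C₃ * Ē := rfl
    rw [hαt]
    linarith [hst, hmono]
  have hmain := sq_norm_curl_le_of_stretching_forced hν hT'' hS hB hG hI hdiss hα hαT hC₄ hstr'
  intro t ht
  refine (hmain t ht).trans (mul_le_mul_of_nonneg_left (Real.exp_le_exp.2 ?_) (by positivity))
  have h := ENNReal.toReal_mono ENNReal.ofReal_ne_top hαbound
  rw [ENNReal.toReal_ofReal (by positivity)] at h
  nlinarith [h, hT''.le]

end Literature.Analysis.FluidPDE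

end
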